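import Literature.MathematicalPhysics.QuantumLattice.FreeFermionFlatColumn
import Literature.MathematicalPhysics.QuantumLattice.HubbardDWaveLROCeiling
import HarnessLib

/-!
# The free Fermi gas has unboundedly many levels within `c/L` of its sector floor ((H3) fails at `U = 0`)

Topic `MathematicalPhysics/QuantumLattice` (family `hubbard`); proof-only.  Route
`HubbardSuperconductivity/ParityGapRigidity` carries, in its crux `GappedWindow` (stmt-…-2196) and as
hypothesis (H3) of its converse-LSM crux `IncommensurateRigidity` (stmt-…-2195), the LEVEL-COUNT clause
"at most `D` eigenvalues of `H` in the sector `(N_L, S^z = 0)` below `E₀ + c/L`, uniformly in even `L`".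
This file proves that the FREE torus `hubbardTorus 2 L 1 0` violates it at every doping `δ ∈ (0, 1/2)`:

* `exists_span_pairedExcitations` — paired seas over `F ∖ {k₀} ∪ {p t}` (`F` a Fermi set of the
  sector, `k₀` a top level, `p t ∉ F` injective with pair cost `≤ c₁/L`) are orthonormal free
  eigenvectors in `szSector (2n) 0` with eigenvalues `≤ E₀ + c₁/L`; their span has full dimension and
  Rayleigh quotient `≤ E₀ + c₁/L`;
* `exists_lowLying_free_core`, `exists_lowLying_free` — for every `c > 0`, `D`, `L₀` there is an even
  `L ≥ L₀` and `V ≤ szSector N_L 0`, `N_L = 2⌊(1-δ)L²/2⌋`, with Rayleigh quotient `≤ E₀ + c/L` and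
  `finrank V > D` (Fermi level `-4 < e_F < 0` from `fermiLevel_conditions_doping`; the flat column of
  `FreeFermionFlatColumn`; `P = D + 1` particles along it; one hole at the top of `F`).

With the companions (`Summits/…/Theorems/ParityGapRigidityZeroCoupling*.lean`): at the free point the
three spectral clauses of `GappedWindow` read (PG) FALSE (open shells, subsequence), (H3) FALSE (all
large even `L`), (H4) TRUE.  Everything is proved; no definitions, no named facts.  Sources:
J. Bardeen, L. N. Cooper, J. R. Schrieffer, Phys. Rev. 108 (1957) 1175 §II; E. H. Lieb, M. Loss,
*Analysis* Thm 1.14 (bathtub). [folklore]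

## Mathlib / tree search

Tree (REUSED): `fermiLevel_conditions_doping`, `exists_fermiSet`, `minEnergyOn_szSector_free_eq`,
`hubbardTorus_zero_mulVec_pairedState`, `pairedState_mem_szSector`, `star_pairedState_dotProduct_self`,
`span_orthonormal_eigenvectors`, `exists_flat_column_crossing`, `column_pair_cost_le`.
Mathlib: `Nat.sqrt`, `Nat.le_sqrt'`, `Nat.sqrt_le'`, `Finset.exists_max_image`.
-/

noncomputable section

namespace Literature.MathematicalPhysics.QuantumLattice

open Matrix Finset Literature.Probability.LatticeModels
open scoped ComplexOrder ComplexConjugate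

section LowLying

variable {L : ℕ}

/-- **Paired excitations of a free Fermi sea span a low-lying subspace.** Let `F` be a Fermi set
of `n` band levels with top level `e_F = ε(k₀)`, `k₀ ∈ F`, and `p : Fin P → (ℤ/Lℤ)²` an injective
family of momenta outside `F` with pair-excitation cost `2(ε(p t) - e_F) ≤ c₁/L`.  Then the paired
seas over `F ∖ {k₀} ∪ {p t}` are `P` orthonormal eigenvectors of the free torus
`hubbardTorus 2 L 1 0` (`L ≥ 3`) in the sector `(2n, S^z = 0)` with eigenvalues `≤ E₀ + c₁/L`,
`E₀ = 2Σ_F ε` the sector floor; their span `V ≤ szSector (2n) 0` has `finrank V = P` and Rayleigh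
quotient `≤ E₀ + c₁/L` (`span_orthonormal_eigenvectors`). Bardeen–Cooper–Schrieffer (1957) §II.
[folklore] -/
theorem exists_span_pairedExcitations [NeZero L] (hL3 : 3 ≤ L) {n : ℕ} {F : Finset (TorusSite 2 L)}
    (hFc : F.card = n) {eF : ℝ} (hF : ∀ k ∈ F, torusBand L k ≤ eF)
    (hF' : ∀ k ∉ F, eF ≤ torusBand L k) {k₀ : TorusSite 2 L} (hk₀F : k₀ ∈ F)
    (hk₀E : torusBand L k₀ = eF) {P : ℕ} (p : Fin P → TorusSite 2 L)
    (hpinj : Function.Injective p) (hpF : ∀ t, p t ∉ F) {c₁ : ℝ}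
    (hcost : ∀ t, 2 * (torusBand L (p t) - eF) ≤ c₁ / L) :
    ∃ V : Submodule ℂ (Fock (Orb (FermionTorus 2 L))),
      V ≤ szSector (Λ := FermionTorus 2 L) (2 * n) 0 ∧
      (∀ φ ∈ V, (star φ ⬝ᵥ (hubbardTorus 2 L 1 0 *ᵥ φ)).re ≤
        ((hubbardTorus 2 L 1 0).minEnergyOn (szSector (Λ := FermionTorus 2 L) (2 * n) 0) + c₁ / L) *
          (star φ ⬝ᵥ φ).re) ∧
      Module.finrank ℂ V = P := by
  classical
  set H₀ := hubbardTorus 2 L 1 0 with hH₀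
  have hfloor : H₀.minEnergyOn (szSector (Λ := FermionTorus 2 L) (2 * n) 0) = 2 * ∑ k ∈ F, torusBand L k := by
    rw [← hFc]; exact minEnergyOn_szSector_free_eq hL3 F eF hF hF'
  set Ft : Fin P → Finset (TorusSite 2 L) := fun t => insert (p t) (F.erase k₀) with hFt
  have hp' : ∀ t, p t ∉ F.erase k₀ := fun t h => hpF t (Finset.mem_of_mem_erase h)
  have hFtc : ∀ t, (Ft t).card = n := fun t => by
    rw [hFt]; dsimp only
    rw [Finset.card_insert_of_notMem (hp' t), Finset.card_erase_of_mem hk₀F, hFc]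
    have : 1 ≤ n := by rw [← hFc]; exact Finset.card_pos.2 ⟨k₀, hk₀F⟩
    omega
  have hFtsum : ∀ t, ∑ k ∈ Ft t, torusBand L k = ∑ k ∈ F, torusBand L k - eF + torusBand L (p t) := fun t => by
    rw [hFt]; dsimp only
    rw [Finset.sum_insert (hp' t), ← Finset.sum_erase_add F _ hk₀F, hk₀E]
    ring
  set Φ : Fin P → Fock (Orb (FermionTorus 2 L)) := fun t =>
    (List.map (fun k : TorusSite 2 L => (pairMode k)ᴴ) (Ft t).toList).prod *ᵥ
      (vacuum : Fock (Orb (FermionTorus 2 L))) with hΦ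
  have hΦmem : ∀ t, Φ t ∈ szSector (Λ := FermionTorus 2 L) (2 * n) 0 := fun t => by
    rw [hΦ]; dsimp only
    rw [← hFtc t, ← (Ft t).length_toList]
    exact pairedState_mem_szSector (Ft t).toList
  have hon : ∀ i j : Fin P, star (Φ i) ⬝ᵥ Φ j = if i = j then 1 else 0 := by
    intro i j
    by_cases hij : i = j
    · subst hij; rw [if_pos rfl]; exact star_pairedState_dotProduct_self (Ft i).nodup_toList
    · rw [if_neg hij]
      refine star_pairedState_dotProduct_pairedState_eq_zero (q := p j) ?_ ?_
      · rw [Finset.mem_toList, hFt]; exact Finset.mem_insert_self _ _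
      · rw [Finset.mem_toList, hFt]; dsimp only
        rw [Finset.mem_insert, not_or]
        exact ⟨fun h => hij (hpinj h).symm, hp' j⟩
  set E : Fin P → ℝ := fun t => 2 * ∑ k ∈ Ft t, torusBand L k with hEdef
  have hHv : ∀ t, H₀ *ᵥ Φ t = ((E t : ℝ) : ℂ) • Φ t := fun t => by
    rw [hΦ]; dsimp only
    rw [hH₀, hubbardTorus_zero_mulVec_pairedState hL3, Finset.toList_toFinset]
  have hEle : ∀ t, E t ≤ H₀.minEnergyOn (szSector (Λ := FermionTorus 2 L) (2 * n) 0) + c₁ / L := by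
    intro t
    rw [hfloor, hEdef]; dsimp only
    rw [hFtsum t]
    have := hcost t
    linarith
  obtain ⟨hray, hrank⟩ := span_orthonormal_eigenvectors Φ hon H₀ E hHv _ hEle
  refine ⟨Submodule.span ℂ (Set.range Φ), ?_, hray, hrank⟩
  rw [Submodule.span_le]
  rintro _ ⟨i, rfl⟩
  exact hΦmem i

/-- **Core construction.** For `δ ∈ (0, 1/2)`, an even side `L ≥ ⌈160/δ⌉ + 17`, a slack
`0 < c₁ ≤ 32π²` and a count `P ≤ c₁⌊√L⌋/(32π²)`, the free torus `H₀ = hubbardTorus 2 L 1 0` has a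
subspace `V ≤ szSector N_L 0`, `N_L = 2⌊(1-δ)L²/2⌋`, of dimension `P` on which the Rayleigh quotient
is `≤ E₀ + c₁/L` (`fermiLevel_conditions_doping` for a Fermi set with `-4 < e_F < 0`,
`exists_flat_column_crossing`, `column_pair_cost_le`, `exists_span_pairedExcitations`). [folklore] -/
theorem exists_lowLying_free_core {δ : ℝ} (hδ : δ ∈ Set.Ioo (0:ℝ) (1/2)) (L : ℕ) [NeZero L]
    (hL160 : ⌈160 / δ⌉₊ + 17 ≤ L) (hLe : Even L) {c₁ : ℝ} (hc₁ : 0 < c₁)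
    (hc₁' : c₁ ≤ 32 * Real.pi ^ 2) {P : ℕ}
    (hP : (P : ℝ) * (32 * Real.pi ^ 2) ≤ c₁ * (Nat.sqrt L : ℕ)) :
    ∃ V : Submodule ℂ (Fock (Orb (FermionTorus 2 L))),
      V ≤ szSector (Λ := FermionTorus 2 L) (2 * ⌊(1 - δ) * (L : ℝ) ^ 2 / 2⌋₊) 0 ∧
      (∀ φ ∈ V, (star φ ⬝ᵥ (hubbardTorus 2 L 1 0 *ᵥ φ)).re ≤
        ((hubbardTorus 2 L 1 0).minEnergyOn
            (szSector (Λ := FermionTorus 2 L) (2 * ⌊(1 - δ) * (L : ℝ) ^ 2 / 2⌋₊) 0) + c₁ / L) *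
          (star φ ⬝ᵥ φ).re) ∧
      Module.finrank ℂ V = P := by
  classical
  obtain ⟨hδ0, hδ1⟩ := hδ
  have hL3 : 3 ≤ L := by omega
  have hL16 : 16 ≤ L := by omega
  set n : ℕ := ⌊(1 - δ) * (L : ℝ) ^ 2 / 2⌋₊ with hn
  -- (1) Fermi-level bookkeeping at doping `δ`
  obtain ⟨hcount1, hcount2, -⟩ := fermiLevel_conditions_doping ⟨hδ0, hδ1⟩ L hL160 hLe
  have hnc : n ≤ Fintype.card (TorusSite 2 L) := hcount1.trans (Finset.card_le_univ _)
  obtain ⟨F, e0, hFc, hF0, hF0'⟩ := exists_fermiSet (torusBand L) hnc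
  have hFne : F.Nonempty := by
    rw [← Finset.card_pos, hFc]
    exact lt_of_le_of_lt (Nat.zero_le _) hcount2
  obtain ⟨k₀, hk₀F, hk₀max⟩ := Finset.exists_max_image F (torusBand L) hFne
  set eF : ℝ := torusBand L k₀ with heF
  have hF : ∀ k ∈ F, torusBand L k ≤ eF := hk₀max
  have hF' : ∀ k ∉ F, eF ≤ torusBand L k := fun k hk => (hF0 k₀ hk₀F).trans (hF0' k hk)
  have heFup : eF ≤ -((δ / 4) ^ 2) := by
    by_contra hcon
    push Not at hcon
    have hsub : (Finset.univ.filter fun k : TorusSite 2 L => torusBand L k ≤ -((δ / 4) ^ 2)) ⊆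
        F.erase k₀ := by
      intro k hk
      rw [Finset.mem_filter] at hk
      rw [Finset.mem_erase]
      refine ⟨fun h => ?_, ?_⟩
      · rw [h] at hk; linarith [hk.2]
      · by_contra hkF; linarith [hF' k hkF, hk.2]
    have := Finset.card_le_card hsub
    rw [Finset.card_erase_of_mem hk₀F, hFc] at this
    omega
  have heFlow : -4 + (δ / 4) ^ 2 ≤ eF := by
    by_contra hcon
    push Not at hcon
    have hsub : F ⊆ Finset.univ.filter fun k : TorusSite 2 L => torusBand L k < -4 + (δ / 4) ^ 2 :=
      fun k hk => Finset.mem_filter.2 ⟨Finset.mem_univ _, (hF k hk).trans_lt hcon⟩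
    have := Finset.card_le_card hsub
    rw [hFc] at this
    omega
  have hδsq : 0 < (δ / 4) ^ 2 := by positivity
  -- (2) the flat column and its excitations
  obtain ⟨a₀, b, js, hjs1, hjsL, hjs_s, hcol, hjsE, hbelow⟩ :=
    exists_flat_column_crossing hLe hL16 (eF := eF) (by linarith) (by linarith)
  set s : ℕ := Nat.sqrt L with hs
  have hs2 : s ^ 2 ≤ L := Nat.sqrt_le' L
  have hs4 : 4 ≤ s := by rw [hs, Nat.le_sqrt']; omega
  have hs0 : (0 : ℝ) ≤ s := by positivity
  have hPs : P ≤ s := by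
    have : (P : ℝ) ≤ s := by
      have h1 : (P : ℝ) * (32 * Real.pi ^ 2) ≤ (s : ℝ) * (32 * Real.pi ^ 2) :=
        hP.trans (by rw [mul_comm]; exact mul_le_mul_of_nonneg_left hc₁' hs0)
      exact le_of_mul_le_mul_right h1 (by positivity)
    exact_mod_cast this
  have h4s : 4 * s ≤ L :=
    calc 4 * s ≤ s * s := Nat.mul_le_mul_right _ hs4
      _ = s ^ 2 := (sq s).symm
      _ ≤ L := hs2
  have hjtL : ∀ t : ℕ, t < P → js + t < L := fun t ht => by omega
  set p : Fin P → TorusSite 2 L := fun t => ![a₀, (((js + (t : ℕ) : ℕ)) : ZMod L)] with hp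
  have hεp : ∀ t : Fin P, torusBand L (p t) =
      b + 2 * (1 - Real.cos (2 * Real.pi * ((js + (t : ℕ) : ℕ) : ℝ) / L)) := fun t => by
    rw [hp]; dsimp only; exact hcol _ (hjtL t t.isLt)
  have hεlow : b + 2 * (1 - Real.cos (2 * Real.pi * ((js - 1 : ℕ) : ℝ) / L)) ≤ eF := by
    rw [← hcol _ (by omega)]; exact hbelow (js - 1) (by omega)
  have hεjs : eF < b + 2 * (1 - Real.cos (2 * Real.pi * ((js : ℕ) : ℝ) / L)) := by
    rw [← hcol _ (by omega)]; exact hjsE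
  -- monotonicity of the column: `ε(a₀, js) ≤ ε(a₀, js + t)`
  have hLr : (0 : ℝ) < L := by exact_mod_cast (show 0 < L by omega)
  have hp_gt : ∀ t : Fin P, eF < torusBand L (p t) := by
    intro t
    rw [hεp t]
    refine hεjs.trans_le ?_
    have hθ0 : 0 ≤ 2 * Real.pi * ((js : ℕ) : ℝ) / L := by positivity
    have hθπ : 2 * Real.pi * ((js + (t : ℕ) : ℕ) : ℝ) / L ≤ Real.pi := by
      rw [div_le_iff₀ hLr]
      have h2j : (2 * ((js + (t : ℕ) : ℕ) : ℝ)) ≤ L := by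
        exact_mod_cast (show 2 * (js + (t : ℕ)) ≤ L by have := t.isLt; omega)
      calc 2 * Real.pi * ((js + (t : ℕ) : ℕ) : ℝ) = Real.pi * (2 * ((js + (t : ℕ) : ℕ) : ℝ)) := by ring
        _ ≤ Real.pi * L := mul_le_mul_of_nonneg_left h2j Real.pi_pos.le
    have hle : 2 * Real.pi * ((js : ℕ) : ℝ) / L ≤ 2 * Real.pi * ((js + (t : ℕ) : ℕ) : ℝ) / L := by
      rw [div_le_div_iff_of_pos_right hLr]
      have : ((js : ℕ) : ℝ) ≤ ((js + (t : ℕ) : ℕ) : ℝ) := by exact_mod_cast Nat.le_add_right _ _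
      exact mul_le_mul_of_nonneg_left this (by positivity)
    have := Real.cos_le_cos_of_nonneg_of_le_pi hθ0 hθπ hle
    linarith
  have hpF : ∀ t : Fin P, p t ∉ F := fun t h => absurd (hF _ h) (not_le.2 (hp_gt t))
  have hpinj : Function.Injective p := by
    intro t t' h
    have h1 : (((js + (t : ℕ) : ℕ)) : ZMod L) = (((js + (t' : ℕ) : ℕ)) : ZMod L) := by
      have := congrFun h 1
      rw [hp] at this
      simpa using this
    have h2 := congrArg ZMod.val h1
    rw [ZMod.val_natCast, ZMod.val_natCast, Nat.mod_eq_of_lt (hjtL t t.isLt),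
      Nat.mod_eq_of_lt (hjtL t' t'.isLt)] at h2
    exact Fin.ext (by omega)
  have hcost : ∀ t : Fin P, 2 * (torusBand L (p t) - eF) ≤ c₁ / L := by
    intro t
    have h := column_pair_cost_le (L := L) (js := js) (t := (t : ℕ)) (by omega) hs2 hjs1 hjs_s hPs
      t.isLt h4s hc₁ hP
    rw [hεp t]
    linarith
  exact exists_span_pairedExcitations hL3 hFc hF hF' hk₀F rfl p hpinj hpF hcost


/-- **The free Fermi gas violates the level-count clause (H3) at every doping: arbitrarily many
levels within `c/L` of the sector floor.** For `δ ∈ (0, 1/2)`, every `c > 0`, every `D` and every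
`L₀` there is an even side `L ≥ L₀` and a subspace `V ≤ szSector N_L 0`, `N_L = 2⌊(1-δ)L²/2⌋`, of
the Fock space of the free torus `hubbardTorus 2 L 1 0` with Rayleigh quotient `≤ E₀ + c/L`
throughout and `finrank V > D` (`exists_lowLying_free_core` with `c₁ = min c 32π²`, `P = D + 1`,
`L = 2·max(L₀, ⌈160/δ⌉ + 17, K²)`, `K = ⌈32π²(D+1)/c₁⌉`).  The gapless particle–hole continuum of the
Fermi sea, in the finite-volume currency of route `ParityGapRigidity`'s clause (H3). [folklore] -/
theorem exists_lowLying_free {δ : ℝ} (hδ : δ ∈ Set.Ioo (0:ℝ) (1/2)) {c : ℝ} (hc : 0 < c) (D L₀ : ℕ) :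
    ∃ L : ℕ, L₀ ≤ L ∧ Even L ∧
      ∃ V : Submodule ℂ (Fock (Orb (FermionTorus 2 L))),
        V ≤ szSector (Λ := FermionTorus 2 L) (2 * ⌊(1 - δ) * (L : ℝ) ^ 2 / 2⌋₊) 0 ∧
        (∀ φ ∈ V, (star φ ⬝ᵥ (hubbardTorus 2 L 1 0 *ᵥ φ)).re ≤
          ((hubbardTorus 2 L 1 0).minEnergyOn
              (szSector (Λ := FermionTorus 2 L) (2 * ⌊(1 - δ) * (L : ℝ) ^ 2 / 2⌋₊) 0) + c / L) *
            (star φ ⬝ᵥ φ).re) ∧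
        D < Module.finrank ℂ V := by
  have hπ := Real.pi_pos
  set c₁ : ℝ := min c (32 * Real.pi ^ 2) with hc₁def
  have hc₁ : 0 < c₁ := lt_min hc (by positivity)
  have hc₁' : c₁ ≤ 32 * Real.pi ^ 2 := min_le_right _ _
  have hc₁c : c₁ ≤ c := min_le_left _ _
  set K : ℕ := ⌈((D + 1 : ℕ) : ℝ) * (32 * Real.pi ^ 2) / c₁⌉₊ with hK
  set M : ℕ := max (max L₀ (⌈160 / δ⌉₊ + 17)) (K ^ 2) with hM
  set L : ℕ := 2 * M with hLdef
  have hLe : Even L := ⟨M, by rw [hLdef]; ring⟩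
  have hL0 : L₀ ≤ L := by
    have : L₀ ≤ M := (le_max_left _ _).trans (le_max_left _ _)
    omega
  have hL160 : ⌈160 / δ⌉₊ + 17 ≤ L := by
    have : ⌈160 / δ⌉₊ + 17 ≤ M := (le_max_right _ _).trans (le_max_left _ _)
    omega
  have hKL : K ^ 2 ≤ L := by
    have : K ^ 2 ≤ M := le_max_right _ _
    omega
  haveI : NeZero L := ⟨by omega⟩
  have hKs : K ≤ Nat.sqrt L := Nat.le_sqrt'.2 hKL
  -- `P = D + 1` particles fit: `(D+1)·32π² ≤ c₁ K ≤ c₁ ⌊√L⌋`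
  have hP : ((D + 1 : ℕ) : ℝ) * (32 * Real.pi ^ 2) ≤ c₁ * (Nat.sqrt L : ℕ) := by
    have h1 : ((D + 1 : ℕ) : ℝ) * (32 * Real.pi ^ 2) / c₁ ≤ K := Nat.le_ceil _
    rw [div_le_iff₀ hc₁] at h1
    have h2 : (K : ℝ) ≤ (Nat.sqrt L : ℕ) := by exact_mod_cast hKs
    calc ((D + 1 : ℕ) : ℝ) * (32 * Real.pi ^ 2) ≤ K * c₁ := h1
      _ = c₁ * K := mul_comm _ _
      _ ≤ c₁ * (Nat.sqrt L : ℕ) := mul_le_mul_of_nonneg_left h2 hc₁.le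
  obtain ⟨V, hV, hray, hrank⟩ := exists_lowLying_free_core hδ L hL160 hLe hc₁ hc₁' (P := D + 1) hP
  refine ⟨L, hL0, hLe, V, hV, fun φ hφ => ?_, by omega⟩
  have h := hray φ hφ
  have hnn : 0 ≤ (star φ ⬝ᵥ φ).re := (Complex.nonneg_iff.1 (dotProduct_star_self_nonneg φ)).1
  have hLr : (0 : ℝ) < L := by exact_mod_cast (show 0 < L by omega)
  have hcL : c₁ / L ≤ c / L := div_le_div_of_nonneg_right hc₁c hLr.le
  have := mul_le_mul_of_nonneg_right (add_le_add_right hcL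
    ((hubbardTorus 2 L 1 0).minEnergyOn (szSector (Λ := FermionTorus 2 L) (2 * ⌊(1 - δ) * (L : ℝ) ^ 2 / 2⌋₊) 0))) hnn
  exact h.trans this

end LowLying



end Literature.MathematicalPhysics.QuantumLattice

end
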